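import Summits.HodgeConjecture.HodgeConjecture.Theorems.BallQuotientHodgeAbsolute.Negative.ChartConjugationUniqueness
import Literature.AlgebraicGeometry.HodgeTheory.AbsoluteHodgeClasses
import Literature.AlgebraicGeometry.HodgeTheory.TopDegreeClasses
import Literature.AlgebraicGeometry.Motives.ComplexPointsManifold
import Literature.AlgebraicTopology.SingularHomology.CohomologyOfPoint
import Literature.AlgebraicTopology.SingularHomology.CupProduct
import Literature.Geometry.Kaehler.ChernCharacter
import Literature.Geometry.Kaehler.ComplexTorusHodge
import Literature.Geometry.Kaehler.ManifoldFormsPullback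
import HarnessLib

/-!
# Boundary readout — degree-zero conjugation charts: the toolkit

Route `BoundaryReadout` of the Hodge conjecture, crux #2 `BoundarySupply` (stmt-HodgeConjecture-15912);
companion `BoundaryReadoutBoundarySupplyDegreeZero` draws the consequences (every rational degree-zero class
on a smooth projective `X/ℂ` is ABSOLUTE HODGE; the `p = 0` case of the crux and of the registered stub
`CycleClassesAbsolute`; the exact content of the crux). This file is the degree-zero analysis of the tree's
conjugation charts (`ConjugationChart`, `IsConjugateClass` of `AbsoluteHodgeClasses`), which in degree `0`
needs neither Jouanolou's device (`jouanolou_cohomologyChart`) nor Grothendieck's comparison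
(`chartConjugation_canonical`):

* `H⁰` toolkit — `Z⁰ ⟶ H⁰` injective, `H⁰ = ℂ · 1` on a path-connected space, rational degree-zero classes
  are `ℚ · 1`, `1 ≠ 0`, POINTWISE INJECTIVITY of `H⁰` (`singularCohomology_zero_eq_zero_of_forall_const`);
* the DEGREE-ZERO SCALAR of a natural complex de Rham family `e` on `E`-manifolds (`exists_unitScalar`):
  one `λ_e ∈ ℂˣ` with `e_M[1] = λ_e · 1` for EVERY `M` (naturality along the constant maps `E → M`), and
  `λ_e ∈ ℚˣ` when `e` is rationally normalised in degree `0` (`exists_rat_unitScalar`, the constant `1` on a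
  complex torus) — junk analysis (2) of `AbsoluteHodgeClasses`, a theorem in degree `0`;
* conjugate varieties — `Y(ℂ) ≠ ∅ ⇒ Y^σ(ℂ) ≠ ∅`, and **conjugation of functions is `σ` on values**
  (`exists_untwist`: `(pr₁^* s)(Q) = σ(s(P))` at `P = Spec σ⁻¹ ≫ Q ≫ pr₁`, Charles–Schnell (11.2.2));
* `0`-form expressions — `∑ fⱼ` realises to the function `∑ fⱼ`, the constant expression `κ · 1` to `κ`,
  its conjugate to `σ κ`; a closed `0`-form with class `κ · [1]` is the constant `κ`;
* a complex point is an affine probe injective on `H⁰` of a smooth projective target.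

References: [CharlesSchnell2014Notes] §11.2.2 (11.2.1)–(11.2.3); [HatcherAT2002] §3.1 p. 199, §3.2 p. 211;
[BottTu1982Forms] §I.1, §I.5; [GriffithsHarris1978] Ch. 2 §6; [SGA1] Exp. XII Prop. 2.4; [SerreGAGA1956] §2.
-/

set_option linter.dupNamespace false -- decls of this problem live in `Summit.HodgeConjecture.HodgeConjecture.…`

noncomputable section

namespace Summit.HodgeConjecture.HodgeConjecture.Theorems

open CategoryTheory CategoryTheory.Limits AlgebraicGeometry
open scoped Manifold ContDiff
open Literature.AlgebraicTopology.SingularHomology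
open Literature.AlgebraicGeometry.Motives Literature.AlgebraicGeometry.HodgeTheory
open Literature.NumberTheory.Transcendental Literature.Geometry.Kaehler
open Summit.HodgeConjecture.HodgeConjecture.Theorems.BallQuotientHodgeAbsolute.Negative

/-! ### `H⁰` toolkit: the unit class, rational classes, pointwise injectivity -/

section HZero

variable {M : Type} [TopologicalSpace M]

/-- In degree `0` the quotient map `Z⁰ ⟶ H⁰` is injective (no coboundaries). [cite: HatcherAT2002, §3.1 p. 199] -/
theorem singularCohomology_π_zero_injective : Function.Injective (singularCohomology.π ℂ ℂ M 0) := by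
  haveI : IsIso (singularCohomology.π ℂ ℂ M 0) := by
    change IsIso ((singularCochainComplex ℂ ℂ M).homologyπ 0)
    exact (CochainComplex.isoHomologyπ₀ (singularCochainComplex ℂ ℂ M)).isIso_hom
  exact (ModuleCat.mono_iff_injective (singularCohomology.π ℂ ℂ M 0)).1 inferInstance

/-- A `0`-simplex pushed along a constant map is the `0`-simplex at the constant. [cite: HatcherAT2002, §2.1] -/
theorem SingularSimplex.map_const_eq_ofPoint {P : Type} [TopologicalSpace P] (τ : SingularSimplex P 0)
    (x : M) : τ.map (ContinuousMap.const P x) = SingularSimplex.ofPoint x := by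
  rw [← SingularSimplex.ofPoint_pt (τ.map (ContinuousMap.const P x))]
  congr 1

/-- **Pointwise injectivity of `H⁰`.** A class in `H⁰(M; ℂ)` whose pull-back along every constant
map `P → M` (from a fixed nonempty probe `P`) vanishes is zero: a `0`-cocycle is a function on points,
and `(const x)^♯` evaluates it at `x`. [cite: HatcherAT2002, §3.1 p. 199] -/
theorem singularCohomology_zero_eq_zero_of_forall_const {P : Type} [TopologicalSpace P] [Nonempty P]
    (z : singularCohomology ℂ ℂ M 0)
    (hz : ∀ x : M, singularCohomology.map ℂ ℂ (ContinuousMap.const P x) 0 z = 0) : z = 0 := by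
  induction z using singularCohomology_induction_on with
  | h w =>
    have hw : ∀ x : M, singularCochainComplex.cocyclesMap ℂ ℂ (ContinuousMap.const P x) 0 w = 0 := by
      intro x
      apply singularCohomology_π_zero_injective
      rw [← singularCohomology.map_π, hz x, map_zero]
    have : w = 0 := by
      apply (ModuleCat.mono_iff_injective (singularCochainComplex.iCocycles ℂ ℂ M 0)).1 inferInstance
      rw [map_zero]
      refine singularCochainComplex.ext fun τ ↦ ?_
      obtain ⟨p⟩ := ‹Nonempty P›
      have h := congrArg (fun v ↦ (singularCochainComplex.iCocycles ℂ ℂ P 0 v) (SingularSimplex.ofPoint p))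
        (hw τ.pt)
      simp only [map_zero, singularCochainComplex.iCocycles_cocyclesMap,
        singularCochainComplex.map_apply] at h
      rw [SingularSimplex.map_const_eq_ofPoint, SingularSimplex.ofPoint_pt] at h
      exact h
    rw [this, map_zero]

/-- `H⁰(M; ℂ) = ℂ · 1` for `M` path connected: every class is `ε(a) · 1` with `ε` the evaluation
`singularCohomologyZeroEquiv` (copy of the tree's `singularCohomology.eq_smul_one`, kept out of its heavy
import cone). [cite: HatcherAT2002, §3.1 p. 199] -/
theorem singularCohomology_zero_eq_smul_one [PathConnectedSpace M] (a : singularCohomology ℂ ℂ M 0) :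
    a = (singularCohomologyZeroEquiv ℂ ℂ M a) • singularCohomology.one ℂ M := by
  apply (singularCohomologyZeroEquiv ℂ ℂ M).injective
  have h1 : singularCohomologyZeroEquiv ℂ ℂ M (singularCohomology.one ℂ M) = 1 := by
    rw [singularCohomology.one, singularCohomologyZeroEquiv_π,
      singularCochainComplex.cocyclesZeroEquiv_apply, singularCochainComplex.iCocycles_mk]
    rfl
  rw [map_smul, smul_eq_mul, h1, mul_one]

/-- **Rational classes of degree `0` are rational multiples of `1`** on a path-connected space: a
`ℚ`-valued `0`-cocycle is the constant `q`, whose class is `q · 1`. [cite: HatcherAT2002, §3.1 p. 199] -/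
theorem exists_rat_eq_smul_one_of_isRationalClass [PathConnectedSpace M] {c : singularCohomology ℂ ℂ M 0}
    (hc : IsRationalClass c) : ∃ q : ℚ, c = (q : ℂ) • singularCohomology.one ℂ M := by
  obtain ⟨z, rfl, hz⟩ := hc
  obtain ⟨q, hq⟩ := hz (SingularSimplex.ofPoint (Classical.arbitrary M))
  refine ⟨q, ?_⟩
  conv_lhs => rw [singularCohomology_zero_eq_smul_one (singularCohomology.π ℂ ℂ M 0 z)]
  rw [singularCohomologyZeroEquiv_π, singularCochainComplex.cocyclesZeroEquiv_apply, ← hq]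
  rfl

/-- The unit `1 ∈ H⁰(M; ℂ)` of a NONEMPTY space is nonzero (its cocycle takes the value `1` at a
point, and `Z⁰ ⟶ H⁰` is injective). [cite: HatcherAT2002, §3.2 p. 211] -/
theorem singularCohomology_one_ne_zero [Nonempty M] : singularCohomology.one ℂ M ≠ 0 := by
  intro h
  rw [singularCohomology.one] at h
  have h2 := singularCohomology_π_zero_injective (h.trans (map_zero _).symm)
  have h3 := congrArg
    (fun v ↦ (singularCochainComplex.iCocycles ℂ ℂ M 0 v) (SingularSimplex.ofPoint (Classical.arbitrary M))) h2
  simp only [singularCochainComplex.iCocycles_mk, map_zero] at h3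
  exact one_ne_zero h3

/-- On a nonempty space, `a · 1 = b · 1` in `H⁰` forces `a = b`. [cite: HatcherAT2002, §3.2 p. 211] -/
theorem smul_one_injective [Nonempty M] {a b : ℂ}
    (h : a • singularCohomology.one ℂ M = b • singularCohomology.one ℂ M) : a = b := by
  have h2 : (a - b) • singularCohomology.one ℂ M = 0 := by rw [sub_smul, h, sub_self]
  rcases smul_eq_zero.1 h2 with h3 | h3
  · exact sub_eq_zero.1 h3
  · exact absurd h3 singularCohomology_one_ne_zero

end HZero

/-! ### The degree-zero scalar of a natural de Rham family: `e[1] = λ_e · 1`, `λ_e ∈ ℚˣ` -/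

section UnitScalar

variable {E : Type} [NormedAddCommGroup E] [NormedSpace ℂ E]

/-- The unit de Rham class pulls back to the unit de Rham class along a `C^∞` map (`f^* 1 = 1` on
functions). [cite: BottTu1982Forms, §I.1] -/
theorem complexDeRhamCohomology_map_one {M N : Type} [TopologicalSpace M] [ChartedSpace E M]
    [IsManifold 𝓘(ℝ, E) ∞ M] [TopologicalSpace N] [ChartedSpace E N] [IsManifold 𝓘(ℝ, E) ∞ N]
    {f : M → N} (hf : ContMDiff 𝓘(ℝ, E) 𝓘(ℝ, E) ∞ f) :
    complexDeRhamCohomology.map E hf 0 (complexDeRhamCohomology.one E N) = complexDeRhamCohomology.one E M := by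
  rw [complexDeRhamCohomology.one, complexDeRhamCohomology.map_mk, complexDeRhamCohomology.one]
  rfl

/-- In degree `0` there are no exact forms, so a closed `0`-form IS its de Rham class: `[α] = [β] → α = β`
(`cexactSmoothForms E M 0 = ⊥`). [cite: BottTu1982Forms, §I.1] -/
theorem complexDeRhamCohomology_mk_zero_injective {M : Type} [TopologicalSpace M] [ChartedSpace E M] :
    Function.Injective (complexDeRhamCohomology.mk E M 0) := by
  intro α β h
  rw [complexDeRhamCohomology.mk_eq_mk_iff] at h
  change (α : MForm 𝓘(ℝ, E) M ℂ 0) - β ∈ (⊥ : Submodule ℂ _) at h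
  rw [Submodule.mem_bot, sub_eq_zero] at h
  exact Subtype.ext h

/-- A closed smooth `0`-form whose de Rham class is `κ · [1]` IS the constant form `κ · 1` (no exact
`0`-forms), hence takes the value `κ` everywhere. [cite: BottTu1982Forms, §I.1] -/
theorem apply_eq_of_mk_eq_smul_one {M : Type} [TopologicalSpace M] [ChartedSpace E M]
    {α : MForm 𝓘(ℝ, E) M ℂ 0} (hα : α ∈ cclosedSmoothForms E M 0) {κ : ℂ}
    (h : complexDeRhamCohomology.mk E M 0 ⟨α, hα⟩ = κ • complexDeRhamCohomology.one E M) (x : M)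
    (v : Fin 0 → E) : α x v = κ := by
  rw [complexDeRhamCohomology.one, ← map_smul] at h
  have h2 := congrArg (fun β : cclosedSmoothForms E M 0 ↦ (β : MForm 𝓘(ℝ, E) M ℂ 0) x v)
    (complexDeRhamCohomology_mk_zero_injective h)
  simpa [coe_cclosedOne, MForm.ofFun_apply] using h2

/-- The unit de Rham class of a nonempty manifold is nonzero (the constant function `1` is not the
zero form). [cite: BottTu1982Forms, §I.1] -/
theorem complexDeRhamCohomology_one_ne_zero {M : Type} [TopologicalSpace M] [ChartedSpace E M] [Nonempty M] :
    complexDeRhamCohomology.one E M ≠ 0 := by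
  intro h
  rw [complexDeRhamCohomology.one, ← (complexDeRhamCohomology.mk E M 0).map_zero] at h
  have h2 := congrArg (fun α : cclosedSmoothForms E M 0 ↦ (α : MForm 𝓘(ℝ, E) M ℂ 0) (Classical.arbitrary M) Fin.elim0)
    (complexDeRhamCohomology_mk_zero_injective h)
  simp [coe_cclosedOne, MForm.ofFun_apply] at h2

/-- `e_M[κ · 1] = (κ λ) · 1` as soon as `e_M[1] = λ · 1`: the comparison of a constant closed `0`-form.
[cite: BottTu1982Forms, §I.5] -/
theorem apply_mk_smul_cclosedOne (e : ComplexDeRhamIsoFamily E) {M : Type} [TopologicalSpace M]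
    [ChartedSpace E M] [IsManifold 𝓘(ℝ, E) ∞ M] [T2Space M] [SigmaCompactSpace M] {l : ℂ}
    (hl : e M 0 (complexDeRhamCohomology.one E M) = l • singularCohomology.one ℂ M) (κ : ℂ) :
    e M 0 (complexDeRhamCohomology.mk E M 0 (κ • cclosedOne E M)) = (κ * l) • singularCohomology.one ℂ M := by
  rw [map_smul, ← complexDeRhamCohomology.one, map_smul, hl, smul_smul]

variable [FiniteDimensional ℂ E]

/-- **The degree-zero scalar of a NATURAL complex de Rham comparison family `e` on `E`-manifolds**: there
is ONE `λ_e ∈ ℂˣ` with `e_M[1] = λ_e · 1 ∈ H⁰(M; ℂ)` for EVERY manifold `M` charted on `E` (possibly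
disconnected): `λ_e` is read off on the model space `E` (path connected), transported to `M` along the
constant maps `E → M` (naturality; `f^* 1 = 1` on both sides) by pointwise injectivity of `H⁰`, and is
nonzero because `e_E` is injective and `[1] ≠ 0`. For de Rham's integration family `λ_e = 1`; rescaling a
natural family by `t₀` in degree `0` gives `λ_e = t₀` (junk analysis (2) of `AbsoluteHodgeClasses`).
[cite: BottTu1982Forms, §I.5] -/
theorem exists_unitScalar (e : ComplexDeRhamIsoFamily E) (he : e.IsNatural) :
    ∃ l : ℂ, l ≠ 0 ∧ ∀ (M : Type) [TopologicalSpace M] [ChartedSpace E M] [IsManifold 𝓘(ℝ, E) ∞ M]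
      [T2Space M] [SigmaCompactSpace M],
      e M 0 (complexDeRhamCohomology.one E M) = l • singularCohomology.one ℂ M := by
  set l : ℂ := singularCohomologyZeroEquiv ℂ ℂ E (e E 0 (complexDeRhamCohomology.one E E))
  have hE : e E 0 (complexDeRhamCohomology.one E E) = l • singularCohomology.one ℂ E :=
    singularCohomology_zero_eq_smul_one _
  refine ⟨l, fun h ↦ ?_, fun M _ _ _ _ _ ↦ ?_⟩
  · rw [h, zero_smul, ← (e E 0).map_zero] at hE
    exact complexDeRhamCohomology_one_ne_zero ((e E 0).injective hE)
  · rw [← sub_eq_zero]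
    refine singularCohomology_zero_eq_zero_of_forall_const (P := E) _ fun x ↦ ?_
    have hc : ContMDiff 𝓘(ℝ, E) 𝓘(ℝ, E) ∞ (fun _ : E ↦ x) := contMDiff_const
    have hnat := he E M (fun _ ↦ x) hc 0 (complexDeRhamCohomology.one E M)
    rw [complexDeRhamCohomology_map_one hc, hE] at hnat
    have hconst : (⟨fun _ ↦ x, hc.continuous⟩ : C(E, M)) = ContinuousMap.const E x := rfl
    rw [hconst] at hnat
    rw [map_sub, map_smul, singularCohomology.map_one, ← hnat, sub_self]

/-- **The degree-zero scalar is RATIONAL for a natural family rationally normalised in degree `0`**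
(`IsRationalDeRhamFamily e 0`): on a complex torus `E/Λ` (any real frame `Λ` of `E`) the constant `0`-form
`1` has the rational value `1` on the (empty) lattice `0`-tuples, so `e[1] = λ_e · 1` is a rational class,
and rational degree-zero classes are `ℚ · 1`. This is the cancellation "`c₀ ∈ ℚˣ`" of the junk analysis (2)
of `AbsoluteHodgeClasses`, in degree `0`. [cite: BottTu1982Forms, §I.5]
[cite: GriffithsHarris1978, Ch. 2 §6 (cohomology of complex tori)] -/
theorem exists_rat_unitScalar (e : ComplexDeRhamIsoFamily E) (he : e.IsNatural)
    (hr : IsRationalDeRhamFamily e 0) :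
    ∃ q : ℚ, (q : ℂ) ≠ 0 ∧ ∀ (M : Type) [TopologicalSpace M] [ChartedSpace E M] [IsManifold 𝓘(ℝ, E) ∞ M]
      [T2Space M] [SigmaCompactSpace M],
      e M 0 (complexDeRhamCohomology.one E M) = (q : ℂ) • singularCohomology.one ℂ M := by
  obtain ⟨l, hl0, hl⟩ := exists_unitScalar e he
  let Φ : (Fin (Module.finrank ℝ E) → ℝ) ≃L[ℝ] E := (Module.finBasis ℝ E).equivFunL.symm
  let a : E [⋀^Fin 0]→L[ℝ] ℂ := ContinuousAlternatingMap.constOfIsEmpty ℝ E (Fin 0) 1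
  have ha : ∀ v : Fin 0 → Fin (Module.finrank ℝ E),
      a (fun j ↦ Φ (Pi.single (v j) 1)) ∈ Set.range (algebraMap ℚ ℂ) := fun v ↦ ⟨1, by simp [a]⟩
  have hrat := hr (Fin (Module.finrank ℝ E)) Φ a ha
  have hcc : ComplexTorus.cconstClass Φ a = complexDeRhamCohomology.one E (ComplexTorus Φ) := by
    rw [ComplexTorus.cconstClass_apply, complexDeRhamCohomology.one]
    congr 1
  rw [hcc, hl] at hrat
  obtain ⟨q, hq⟩ := exists_rat_eq_smul_one_of_isRationalClass hrat
  obtain rfl : l = q := smul_one_injective hq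
  exact ⟨q, hl0, hl⟩

end UnitScalar

/-! ### Complex points of conjugate varieties; values of conjugate functions -/

section Points

variable {Y : SchemeOver ℂ}

/-- **The conjugate of a scheme with a complex point has a complex point**: `P ∈ Y(ℂ)` gives the
`ℂ`-point `(Spec σ ≫ P, 𝟙)` of `Y^σ = Y ×_{ℂ,σ} Spec ℂ`. [cite: CharlesSchnell2014Notes, §11.2.2 (11.2.1)] -/
theorem nonempty_complexPoints_conjugateVariety (σ : ℂ ≃+* ℂ) [h : Nonempty (ComplexPoints Y)] :
    Nonempty (ComplexPoints (conjugateVariety σ Y)) := by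
  obtain ⟨P⟩ := h
  exact ⟨(ComplexPoints.homEquiv ((baseChangeHom σ.toRingHom).obj Y)).symm
    ⟨pullback.lift (Spec.map (CommRingCat.ofHom σ.toRingHom) ≫ P.toSpecHom) (𝟙 _)
        (by rw [Category.assoc, P.toSpecHom_comp_hom, Category.comp_id, Category.id_comp]),
      pullback.lift_snd _ _ _⟩⟩

/-- **Conjugation of functions is `σ` on values.** For `Q ∈ Y^σ(ℂ)` there is a complex point `P` of `Y`
(the untwisted point `Spec σ⁻¹ ≫ Q ≫ pr₁`) such that every conjugate function `pr₁^* s ∈ Γ(Y^σ, 𝒪)` takes at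
`Q` the value `σ(s(P))` (naturality of `Γ(Spec ℂ) ≅ ℂ`, Mathlib `Scheme.ΓSpecIso_naturality`) — Charles–
Schnell's `α ↦ α^σ` (11.2.2) in degree `0`, on points. [cite: CharlesSchnell2014Notes, §11.2.2 (11.2.2)] -/
theorem exists_untwist (σ : ℂ ≃+* ℂ) (Q : ComplexPoints ((baseChangeHom σ.toRingHom).obj Y)) :
    ∃ P : ComplexPoints Y, ∀ s : Γ(Y.left, ⊤),
      Q.eval ⊤ trivial ((baseChangeHomFst σ.toRingHom Y).appTop s) = σ (P.eval ⊤ trivial s) := by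
  have hQ := Q.toSpecHom_comp_hom
  have hc : baseChangeHomFst σ.toRingHom Y ≫ Y.hom =
      ((baseChangeHom σ.toRingHom).obj Y).hom ≫ Spec.map (CommRingCat.ofHom σ.toRingHom) :=
    pullback.condition
  have hστ : CommRingCat.ofHom σ.toRingHom ≫ CommRingCat.ofHom σ.symm.toRingHom = 𝟙 _ := by
    ext x
    simp
  let P : ComplexPoints Y := (ComplexPoints.homEquiv Y).symm
    ⟨Spec.map (CommRingCat.ofHom σ.symm.toRingHom) ≫ Q.toSpecHom ≫ baseChangeHomFst σ.toRingHom Y, by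
      simp only [Category.assoc]
      rw [hc, ← Category.assoc Q.toSpecHom, hQ, Category.id_comp, ← Spec.map_comp, hστ, Spec.map_id]⟩
  have hP : P.toSpecHom =
      Spec.map (CommRingCat.ofHom σ.symm.toRingHom) ≫ Q.toSpecHom ≫ baseChangeHomFst σ.toRingHom Y := rfl
  refine ⟨P, fun s ↦ ?_⟩
  apply σ.symm.injective
  rw [RingEquiv.symm_apply_apply, AlgPoints.eval_top, AlgPoints.eval_top, hP, Scheme.Hom.comp_appTop,
    Scheme.Hom.comp_appTop]
  have h2 := congrArg (fun φ ↦ φ.hom (Q.toSpecHom.appTop.hom ((baseChangeHomFst σ.toRingHom Y).appTop.hom s)))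
    (Scheme.ΓSpecIso_naturality (CommRingCat.ofHom σ.symm.toRingHom))
  simp only [CommRingCat.hom_comp, RingHom.comp_apply, CommRingCat.hom_ofHom] at h2
  exact h2.symm

end Points

/-! ### Algebraic `0`-form expressions: functions, constants, and their realisations -/

section Expressions

variable {Y : SchemeOver ℂ} {E : Type} [NormedAddCommGroup E] [NormedSpace ℂ E] [FiniteDimensional ℂ E] {m : ℕ}

/-- A `0`-form expression `∑ⱼ fⱼ` realises to the function `x ↦ ∑ⱼ fⱼ(x)` (as a `0`-form: its value on
the empty tuple). [cite: Grothendieck1966, Thm. 1'] -/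
theorem realize_apply_of_degree_zero (ξ : AlgFormExpr Y 0) (A : AnalyticModel E m Y) (x : A.carrier)
    (v : Fin 0 → E) : ξ.realize A x v = ∑ j : Fin ξ.size, A.regularFun (ξ.coef j) x := by
  unfold AlgFormExpr.realize
  rw [Finset.sum_apply, ContinuousAlternatingMap.sum_apply]
  refine Finset.sum_congr rfl fun j _ ↦ ?_
  simp [dWedge, MForm.ofFun_apply]

/-- A regular function, read on an analytic model, is its value at the corresponding complex point.
[cite: SerreGAGA1956, §2] -/
theorem regularFun_eq_eval (A : AnalyticModel E m Y) (s : Γ(Y.left, ⊤)) (x : A.carrier) :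
    A.regularFun s x = (A.toComplexPoints x).eval ⊤ trivial s := by
  simp only [AnalyticModel.regularFun, AlgPoints.evalOrZero_of_mem _ (TopologicalSpace.Opens.mem_top _)]

/-- The constant function `κ = Y.hom^* κ` reads as `κ` on any analytic model. [cite: SerreGAGA1956, §2] -/
theorem regularFun_const (A : AnalyticModel E m Y) (κ : ℂ) (x : A.carrier) :
    A.regularFun (Y.hom.appTop ((Scheme.ΓSpecIso (.of ℂ)).inv κ)) x = κ := by
  rw [regularFun_eq_eval]
  exact eval_top_const _ κ

/-- **The constant expression `κ · 1`** (one monomial, coefficient the constant function `κ`, no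
differentials) realises to the constant `0`-form `κ`. [cite: Grothendieck1966, Thm. 1'] -/
theorem realize_constExpr (A : AnalyticModel E m Y) (κ : ℂ) :
    (⟨1, fun _ ↦ Y.hom.appTop ((Scheme.ΓSpecIso (.of ℂ)).inv κ), fun _ ↦ Fin.elim0⟩ : AlgFormExpr Y 0).realize A =
      κ • MForm.ofFun 𝓘(ℝ, E) fun _ : A.carrier ↦ (1 : ℂ) := by
  funext x
  ext v
  rw [realize_apply_of_degree_zero]
  simp only [Finset.univ_unique, Fin.default_eq_zero, Finset.sum_singleton]
  rw [regularFun_const]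
  simp [MForm.ofFun_apply]

/-- **The conjugate of the constant expression `κ · 1` realises to the constant `σ κ`** on any analytic
model of `Y^σ` (`appTop_fst_const`: the constant `κ` pulls back along `Y^σ → Y` to the constant `σ κ`).
[cite: CharlesSchnell2014Notes, §11.2.2 (11.2.2)] -/
theorem realize_conj_constExpr (σ : ℂ ≃+* ℂ) (A' : AnalyticModel E m (conjugateVariety σ Y)) (κ : ℂ) :
    ((⟨1, fun _ ↦ Y.hom.appTop ((Scheme.ΓSpecIso (.of ℂ)).inv κ), fun _ ↦ Fin.elim0⟩ : AlgFormExpr Y 0).conj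
        σ).realize A' = σ κ • MForm.ofFun 𝓘(ℝ, E) fun _ : A'.carrier ↦ (1 : ℂ) := by
  funext x
  ext v
  rw [realize_apply_of_degree_zero]
  simp only [AlgFormExpr.conj, Finset.univ_unique, Fin.default_eq_zero, Finset.sum_singleton]
  rw [appTop_fst_const σ Y κ, regularFun_const]
  simp [MForm.ofFun_apply]

end Expressions

/-! ### A complex point is an affine probe injective on `H⁰` -/

section Probe

variable {n : ℕ} {X : SchemeOver ℂ}

/-- `X(ℂ)` is path connected for `X` smooth projective (connected, `connectedSpace_complexPoints`, and
locally path connected as a topological manifold). Local copy of the tree's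
`pathConnectedSpace_complexPoints`, kept out of its import cone. [cite: SGA1, Exp. XII Prop. 2.4] -/
theorem pathConnectedSpace_complexPoints_of_isSmoothProjective (hX : IsSmoothProjective n X) :
    PathConnectedSpace (ComplexPoints X) := by
  letI := hX.chartedSpace
  haveI : ConnectedSpace (ComplexPoints X) := connectedSpace_complexPoints hX
  haveI : LocallyPathConnectedSpace (ComplexPoints X) :=
    ChartedSpace.locallyPathConnectedSpace (H := EuclideanSpace ℝ (Fin (2 * n))) (M := ComplexPoints X)
  exact pathConnectedSpace_iff_connectedSpace.mpr inferInstance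

/-- `g^* 1 = 1` on `H⁰(–(ℂ); ℂ)` for a `ℂ`-morphism `g`. [cite: HatcherAT2002, §3.2 p. 211] -/
theorem complexBetti_map_one {Y Z : SchemeOver ℂ} (g : Y ⟶ Z) :
    complexBetti.map g 0 (singularCohomology.one ℂ (ComplexPoints Z)) = singularCohomology.one ℂ (ComplexPoints Y) :=
  singularCohomology.map_one _

/-- **A complex point is an affine probe injective on `H⁰`**: for `Z(ℂ)` path connected, every
`ℂ`-morphism `g : Y ⟶ Z` from a `Y` with a complex point is injective on `H⁰(–(ℂ); ℂ)` (`H⁰(Z(ℂ)) = ℂ · 1`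
and `g^* 1 = 1 ≠ 0`). [cite: HatcherAT2002, §3.1 p. 199] -/
theorem complexBetti_map_zero_injective {Y Z : SchemeOver ℂ} (g : Y ⟶ Z)
    [PathConnectedSpace (ComplexPoints Z)] [Nonempty (ComplexPoints Y)] :
    Function.Injective (complexBetti.map g 0) := by
  intro a b hab
  rw [singularCohomology_zero_eq_smul_one a, singularCohomology_zero_eq_smul_one b] at hab ⊢
  rw [map_smul, map_smul, complexBetti_map_one] at hab
  rw [smul_one_injective hab]

/-- If `g^*` is injective on `H⁰` and the target has a complex point, so does the source (else `H⁰` of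
the source vanishes and `g^* 1 = g^* 0`). [cite: HatcherAT2002, §3.1] -/
theorem nonempty_complexPoints_of_injective {Y Z : SchemeOver ℂ} (g : Y ⟶ Z) [Nonempty (ComplexPoints Z)]
    (hg : Function.Injective (complexBetti.map g 0)) : Nonempty (ComplexPoints Y) := by
  by_contra h
  haveI : IsEmpty (ComplexPoints Y) := not_nonempty_iff.1 h
  haveI : Subsingleton (complexBetti Y 0) :=
    ModuleCat.subsingleton_of_isZero (isZero_singularCohomology_of_isEmpty ℂ ℂ (E := ComplexPoints Y) 0)
  have h1 : complexBetti.map g 0 (singularCohomology.one ℂ (ComplexPoints Z)) = complexBetti.map g 0 0 :=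
    Subsingleton.elim _ _
  exact singularCohomology_one_ne_zero (hg h1)

end Probe

end Summit.HodgeConjecture.HodgeConjecture.Theorems

end
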